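import Summits.AtomisticToContinuum.FouriersLaw.Theorems.HonestZwanzigRobinCoercivityFluxReduction

/-!
# `HonestZwanzig.RobinCoercivity` — line Sketch (card free-coboundary-thomson-flow): crux skeleton, rev 1 — RETIRED, NOT registered (see `Lines/Sketch-dead.md`: the open stub C is the flux bound itself, by coboundary invariance of `lap_0`)

Crux `stmt-AtomisticToContinuum-12695`, decl `Summit.AtomisticToContinuum.FouriersLaw.Theses.HonestZwanzig.RobinCoercivity`.
Lead c1 (prover-line-stmt-AtomisticToContinuum-12695-c1-0), 2026-08-17.

COMPOSITION. The crux follows from the N-uniform flux bound (`robinCoercivity_of_fluxBound`, LANDED p101879, line LinAlg;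
the flux bound is EQUIVALENT to the crux, p105573). Line Sketch decomposes the flux bound by an explicit THOMSON CERTIFICATE
(the inf side of the flux inequality): for a profile `a` whose static charge `χa` is the divergence of a bond flux `ψ` plus
contact injections `φ₀, φ₁`, take the odd corrector `w = Σ_b η_b j_b` with `C_j η = ψ` (`C_j = [cov(j_b,j_b')]`: exact kill of
the bulk hydrodynamic charge), so that `f_a + A w = (junk q) + φ₀ u₀ + φ₁ u_{N-1}` with `u` the dual energy observables; then
`√lap(f_a) ≤ √lap(A w) + √lap(q) + |φ₀|√lap(u₀) + |φ₁|√lap(u_{N-1})` (T3), `lap(Aw,Aw) ≤ s Var w + γT Σ_∂‖∂_p w‖²`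
(T1 + positivity, statics by T2b and Dynkin T2), and the N-UNIFORM bounds on `lap(q)+γTΣ‖∂_p w‖²`, `lap(u_∂)` are the one
open stub C (`stub_junkContactBound`) — an explicit, more local statement than the crux (false at the harmonic point where the
crux is true; numerically tested in this session). Stubs T1, T2, T2b, T3 are fixed-`N` tools provable from the tree now;
`stub_certificateTransfer` is the glue (fixed-`N` linear algebra + admissibility bookkeeping).

STUBS (registered): `stub_coboundaryIdentity` (T1), `stub_polyDynkin` (T2), `stub_generatorCalculus` (T2b),
`stub_lapSeminorm` (T3), `stub_junkContactBound` (C, open, held by the lead), `stub_certificateTransfer` (glue).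
-/

noncomputable section

open MeasureTheory Finset Matrix
open scoped NNReal
open Literature.MathematicalPhysics.KineticTheory.HeatConduction
open Summit.AtomisticToContinuum.FouriersLaw.Theses.HonestZwanzig

namespace Summit.AtomisticToContinuum.FouriersLaw.Theorems.HonestZwanzig.Robin

/-! ### T1 — the free-coboundary identity (fixed `N`, abstract Dynkin hypotheses) -/

/-- STUB T1 (registered) — **free-coboundary identity.** For admissible `w` with Dynkin pairs `(w, ℓ)` and `(w∘Θ, ℓ')` (so `ℓ = Lw`, `ℓ'∘Θ = L†w`), writing `Aw := (ℓ − ℓ'∘Θ)/2` (Liouville part) and `Bw := s·w − (ℓ + ℓ'∘Θ)/2`: `lap_s(Aw,Aw) + lap_s(Bw,Bw) = cov(w,Bw) − cov(Aw,w)`. From the two Kolmogorov identities (`pinnedChain_kolmogorov_lap`, `…_flip` generalised to non-even observables) and bilinearity of `lap_s`, `cov`. -/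
theorem stub_coboundaryIdentity :
    ∀ ω₂ lam β γ : ℝ, 0 < ω₂ → 0 < lam → 0 < β → 0 < γ → ∀ T : ℝ, 0 < T →
    ∀ N : ℕ, 2 ≤ N → ∀ (Adm : (PhaseSpace N → ℝ) → Prop),
    (∀ f, Adm f ↔ (Continuous f ∧ ∃ A : ℝ, ∀ z,
      |f z| ≤ A * Real.exp ((pinnedChain ω₂ lam β γ).hamiltonian N z / (8 * T)))) →
    ∀ (lap : ℝ → (PhaseSpace N → ℝ) → (PhaseSpace N → ℝ) → ℝ)
      (cov : (PhaseSpace N → ℝ) → (PhaseSpace N → ℝ) → ℝ),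
    (∀ s f g, lap s f g = ∫ t in Set.Ioi (0 : ℝ), Real.exp (-(s * t)) *
      ((∫ z, f z * (∫ y, g y ∂((pinnedChain ω₂ lam β γ).transitionKernel N T T t.toNNReal z))
          ∂(pinnedChain ω₂ lam β γ).gibbsMeasure N T) -
        (∫ z, f z ∂(pinnedChain ω₂ lam β γ).gibbsMeasure N T) *
          (∫ z, g z ∂(pinnedChain ω₂ lam β γ).gibbsMeasure N T))) →
    (∀ f g, cov f g = (∫ z, f z * g z ∂(pinnedChain ω₂ lam β γ).gibbsMeasure N T) -
      (∫ z, f z ∂(pinnedChain ω₂ lam β γ).gibbsMeasure N T) *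
        (∫ z, g z ∂(pinnedChain ω₂ lam β γ).gibbsMeasure N T)) →
    ∀ s : ℝ, 0 < s → ∀ (w ℓ ℓ' : PhaseSpace N → ℝ), Adm w → Adm ℓ → Adm ℓ' →
      (∀ (r : NNReal) (z : PhaseSpace N),
        (∫ y, w y ∂((pinnedChain ω₂ lam β γ).transitionKernel N T T r z)) - w z =
          ∫ u in (0 : ℝ)..(r : ℝ), ∫ y, ℓ y ∂((pinnedChain ω₂ lam β γ).transitionKernel N T T u.toNNReal z)) →
      (∀ (r : NNReal) (z : PhaseSpace N),
        (∫ y, (fun y : PhaseSpace N => w (y.1, -y.2)) y ∂((pinnedChain ω₂ lam β γ).transitionKernel N T T r z)) - (fun y : PhaseSpace N => w (y.1, -y.2)) z =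
          ∫ u in (0 : ℝ)..(r : ℝ), ∫ y, ℓ' y ∂((pinnedChain ω₂ lam β γ).transitionKernel N T T u.toNNReal z)) →
      lap s (fun z => (ℓ z - ℓ' (z.1, -z.2)) / 2) (fun z => (ℓ z - ℓ' (z.1, -z.2)) / 2) +
        lap s (fun z => s * w z - (ℓ z + ℓ' (z.1, -z.2)) / 2) (fun z => s * w z - (ℓ z + ℓ' (z.1, -z.2)) / 2) =
      cov w (fun z => s * w z - (ℓ z + ℓ' (z.1, -z.2)) / 2) - cov (fun z => (ℓ z - ℓ' (z.1, -z.2)) / 2) w := by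
  sorry

/-! ### T2 — Dynkin's identity for polynomially growing `C²` observables -/

/-- STUB T2 (registered) — **Dynkin for polynomial growth.** A `C²` observable `w` with `|w|, |∂_{p_∂} w|, |Lw| ≤ C(1+H)^k` satisfies `P_r w − w = ∫₀ʳ P_u(Lw) du` for the constructed kernels (truncation `w·χ(H/n)`, `pinnedChain_dynkin_of_truncation`). -/
theorem stub_polyDynkin :
    ∀ ω₂ lam β γ : ℝ, 0 < ω₂ → 0 < lam → 0 < β → 0 < γ → ∀ T : ℝ, 0 < T →
    ∀ N : ℕ, 2 ≤ N → ∀ (w ℓ : PhaseSpace N → ℝ) (k : ℕ) (C : ℝ), ContDiff ℝ 2 w → Continuous ℓ →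
      (∀ z, (pinnedChain ω₂ lam β γ).generator N T T w z = ℓ z) →
      (∀ z, |w z| ≤ C * (1 + (pinnedChain ω₂ lam β γ).hamiltonian N z) ^ k) →
      (∀ (i : Fin N) z, (i.val = 0 ∨ i.val = N - 1) → |partialP i w z| ≤ C * (1 + (pinnedChain ω₂ lam β γ).hamiltonian N z) ^ k) →
      (∀ z, |ℓ z| ≤ C * (1 + (pinnedChain ω₂ lam β γ).hamiltonian N z) ^ k) →
      (∀ (r : NNReal) (z : PhaseSpace N),
        (∫ y, w y ∂((pinnedChain ω₂ lam β γ).transitionKernel N T T r z)) - w z =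
          ∫ u in (0 : ℝ)..(r : ℝ), ∫ y, ℓ y ∂((pinnedChain ω₂ lam β γ).transitionKernel N T T u.toNNReal z)) := by
  sorry

/-! ### T2b — generator calculus -/

/-- STUB T2b (registered) — **generator calculus** for `C²` observables: (i) flip `(L(w∘Θ))∘Θ = Lw − 2Aw` with `A` the Liouville operator (= the generator of the `γ = 0` chain); (ii) carré du champ `L(w²) = 2wLw + 2γT Σ_∂ (∂_p w)²`; (iii) the split `L = A + γS`. -/
theorem stub_generatorCalculus :
    ∀ ω₂ lam β γ T : ℝ, ∀ N : ℕ, ∀ w : PhaseSpace N → ℝ, ContDiff ℝ 2 w →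
      (∀ z : PhaseSpace N, (pinnedChain ω₂ lam β γ).generator N T T (fun y => w (y.1, -y.2)) (z.1, -z.2) =
        (pinnedChain ω₂ lam β γ).generator N T T w z - 2 * (pinnedChain ω₂ lam β 0).generator N T T w z) ∧
      (∀ z : PhaseSpace N, (pinnedChain ω₂ lam β γ).generator N T T (fun y => w y ^ 2) z =
        2 * w z * (pinnedChain ω₂ lam β γ).generator N T T w z +
          2 * γ * T * ∑ i : Fin N, ((if i.val = 0 then partialP i w z ^ 2 else 0) +
            (if i.val = N - 1 then partialP i w z ^ 2 else 0))) ∧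
      (∀ z : PhaseSpace N, (pinnedChain ω₂ lam β γ).generator N T T w z = (pinnedChain ω₂ lam β 0).generator N T T w z +
        γ * ∑ i : Fin N, ((if i.val = 0 then T * partialP i (partialP i w) z - z.2 i * partialP i w z else 0) +
          (if i.val = N - 1 then T * partialP i (partialP i w) z - z.2 i * partialP i w z else 0))) := by
  sorry

/-! ### T3 — the seminorm `h ↦ √lap_s(h,h)` -/

/-- STUB T3 (registered) — **`√lap_s(·,·)` is a seminorm on admissible observables**: positivity, Minkowski, homogeneity (from `pinnedChain_lap_self_pos`-type positivity of the resolvent form and bilinearity). -/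
theorem stub_lapSeminorm :
    ∀ ω₂ lam β γ : ℝ, 0 < ω₂ → 0 < lam → 0 < β → 0 < γ → ∀ T : ℝ, 0 < T →
    ∀ N : ℕ, 2 ≤ N → ∀ (Adm : (PhaseSpace N → ℝ) → Prop),
    (∀ f, Adm f ↔ (Continuous f ∧ ∃ A : ℝ, ∀ z,
      |f z| ≤ A * Real.exp ((pinnedChain ω₂ lam β γ).hamiltonian N z / (8 * T)))) →
    ∀ (lap : ℝ → (PhaseSpace N → ℝ) → (PhaseSpace N → ℝ) → ℝ)
      (cov : (PhaseSpace N → ℝ) → (PhaseSpace N → ℝ) → ℝ),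
    (∀ s f g, lap s f g = ∫ t in Set.Ioi (0 : ℝ), Real.exp (-(s * t)) *
      ((∫ z, f z * (∫ y, g y ∂((pinnedChain ω₂ lam β γ).transitionKernel N T T t.toNNReal z))
          ∂(pinnedChain ω₂ lam β γ).gibbsMeasure N T) -
        (∫ z, f z ∂(pinnedChain ω₂ lam β γ).gibbsMeasure N T) *
          (∫ z, g z ∂(pinnedChain ω₂ lam β γ).gibbsMeasure N T))) →
    (∀ f g, cov f g = (∫ z, f z * g z ∂(pinnedChain ω₂ lam β γ).gibbsMeasure N T) -
      (∫ z, f z ∂(pinnedChain ω₂ lam β γ).gibbsMeasure N T) *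
        (∫ z, g z ∂(pinnedChain ω₂ lam β γ).gibbsMeasure N T)) →
    ∀ s : ℝ, 0 < s → ∀ (f g : PhaseSpace N → ℝ), Adm f → Adm g →
      0 ≤ lap s f f ∧
      lap s (fun z => f z + g z) (fun z => f z + g z) ≤
        lap s f f + lap s g g + 2 * Real.sqrt (lap s f f * lap s g g) ∧
      (∀ c : ℝ, lap s (fun z => c * f z) (fun z => c * f z) = c ^ 2 * lap s f f) := by
  sorry

/-! ### C — the explicit junk + contact certificate bound (THE OPEN, N-UNIFORM INPUT OF THE LINE) -/

/-- STUB C (registered, held by the lead) — **N-uniform certificate cost.** There is `K` such that for all `N ≥ 2` and small `s`: (junk) for every profile `a` whose static charge `χa` is the pure bond divergence of `ψ = C_j η`, the corrected fluctuation `f_a + A(Σ_b η_b j_b)` (hydro-orthogonal junk) has `γT Σ_∂ ‖∂_p Σηj‖² + lap_s ≤ K |ψ|²`; (contact) the dual energy observables `u_0, u_{N−1}` (`χ`-dual to `δ_0, δ_{N−1}`) have `lap_s(u,u) ≤ K`. Explicit, local, numerically testable; FALSE at the harmonic point (band-edge dressing), conjectured for `lam, β > 0` (dephasing). -/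
theorem stub_junkContactBound :
    ∀ ω₂ lam β γ : ℝ, 0 < ω₂ → 0 < lam → 0 < β → 0 < γ → ∀ T : ℝ, 0 < T →
    ∃ K : ℝ, 0 < K ∧ ∀ N : ℕ, 2 ≤ N → ∃ s₀ : ℝ, 0 < s₀ ∧
    ∀ (lap : ℝ → (PhaseSpace N → ℝ) → (PhaseSpace N → ℝ) → ℝ)
      (cov : (PhaseSpace N → ℝ) → (PhaseSpace N → ℝ) → ℝ) (e : Fin N → PhaseSpace N → ℝ),
    (∀ s f g, lap s f g = ∫ t in Set.Ioi (0 : ℝ), Real.exp (-(s * t)) *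
      ((∫ z, f z * (∫ y, g y ∂((pinnedChain ω₂ lam β γ).transitionKernel N T T t.toNNReal z))
          ∂(pinnedChain ω₂ lam β γ).gibbsMeasure N T) -
        (∫ z, f z ∂(pinnedChain ω₂ lam β γ).gibbsMeasure N T) *
          (∫ z, g z ∂(pinnedChain ω₂ lam β γ).gibbsMeasure N T))) →
    (∀ f g, cov f g = (∫ z, f z * g z ∂(pinnedChain ω₂ lam β γ).gibbsMeasure N T) -
      (∫ z, f z ∂(pinnedChain ω₂ lam β γ).gibbsMeasure N T) *
        (∫ z, g z ∂(pinnedChain ω₂ lam β γ).gibbsMeasure N T)) →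
    (∀ x z, e x z = z.2 x ^ 2 / 2 + (pinnedChain ω₂ lam β γ).U (z.1 x) +
      ∑ j : Fin N, ((if j.val = x.val + 1 then (pinnedChain ω₂ lam β γ).V (z.1 j - z.1 x) / 2 else 0) +
        (if x.val = j.val + 1 then (pinnedChain ω₂ lam β γ).V (z.1 x - z.1 j) / 2 else 0))) →
    ∀ s : ℝ, 0 < s → s < s₀ →
      (∀ (a η : Fin N → ℝ), (∀ b : Fin N, ¬ (b.val + 1 < N) → η b = 0) →
        (∀ x : Fin N, ∑ y : Fin N, cov (e x) (e y) * a y =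
          ∑ b : Fin N, if b.val + 1 < N then
            ((if x.val = b.val + 1 then (1 : ℝ) else 0) - (if x = b then 1 else 0)) *
              (∑ b' : Fin N, cov ((pinnedChain ω₂ lam β γ).bondCurrent N b) ((pinnedChain ω₂ lam β γ).bondCurrent N b') * η b') else 0) →
        γ * T * (∑ i : Fin N, ((if i.val = 0 then ∫ z, partialP i (fun y : PhaseSpace N => ∑ b : Fin N, η b * (pinnedChain ω₂ lam β γ).bondCurrent N b y) z ^ 2 ∂(pinnedChain ω₂ lam β γ).gibbsMeasure N T else 0) +
            (if i.val = N - 1 then ∫ z, partialP i (fun y : PhaseSpace N => ∑ b : Fin N, η b * (pinnedChain ω₂ lam β γ).bondCurrent N b y) z ^ 2 ∂(pinnedChain ω₂ lam β γ).gibbsMeasure N T else 0))) +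
          lap s (fun z : PhaseSpace N => (∑ x : Fin N, a x * e x z) + (pinnedChain ω₂ lam β 0).generator N T T (fun y : PhaseSpace N => ∑ b : Fin N, η b * (pinnedChain ω₂ lam β γ).bondCurrent N b y) z)
            (fun z : PhaseSpace N => (∑ x : Fin N, a x * e x z) + (pinnedChain ω₂ lam β 0).generator N T T (fun y : PhaseSpace N => ∑ b : Fin N, η b * (pinnedChain ω₂ lam β γ).bondCurrent N b y) z) ≤
        K * ∑ b : Fin N, (∑ b' : Fin N, cov ((pinnedChain ω₂ lam β γ).bondCurrent N b) ((pinnedChain ω₂ lam β γ).bondCurrent N b') * η b') ^ 2) ∧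
      (∀ c : Fin N → ℝ, (∀ x : Fin N, ∑ y : Fin N, cov (e x) (e y) * c y = if x.val = 0 then 1 else 0) →
        lap s (fun z : PhaseSpace N => ∑ y : Fin N, c y * e y z) (fun z : PhaseSpace N => ∑ y : Fin N, c y * e y z) ≤ K) ∧
      (∀ c : Fin N → ℝ, (∀ x : Fin N, ∑ y : Fin N, cov (e x) (e y) * c y = if x.val = N - 1 then 1 else 0) →
        lap s (fun z : PhaseSpace N => ∑ y : Fin N, c y * e y z) (fun z : PhaseSpace N => ∑ y : Fin N, c y * e y z) ≤ K) := by
  sorry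

/-! ### Transfer — certificate calculus ⇒ the flux bound -/

/-- STUB Transfer (registered) — **the certificate gives the flux bound**: T1 → T2 → T2b → T3 → C → `stub_fluxBound` (fixed-`N` linear algebra: `χ`, `C_j` positive definite give the dual contact profiles and `η`; Minkowski in `√lap_s`; `s·Var(w) ≤ |ψ|²` for `s < s₀(N)`; admissibility/Dynkin of the polynomial observables via T2/T2b). -/
theorem stub_certificateTransfer :
    (∀ ω₂ lam β γ : ℝ, 0 < ω₂ → 0 < lam → 0 < β → 0 < γ → ∀ T : ℝ, 0 < T →
    ∀ N : ℕ, 2 ≤ N → ∀ (Adm : (PhaseSpace N → ℝ) → Prop),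
    (∀ f, Adm f ↔ (Continuous f ∧ ∃ A : ℝ, ∀ z,
      |f z| ≤ A * Real.exp ((pinnedChain ω₂ lam β γ).hamiltonian N z / (8 * T)))) →
    ∀ (lap : ℝ → (PhaseSpace N → ℝ) → (PhaseSpace N → ℝ) → ℝ)
      (cov : (PhaseSpace N → ℝ) → (PhaseSpace N → ℝ) → ℝ),
    (∀ s f g, lap s f g = ∫ t in Set.Ioi (0 : ℝ), Real.exp (-(s * t)) *
      ((∫ z, f z * (∫ y, g y ∂((pinnedChain ω₂ lam β γ).transitionKernel N T T t.toNNReal z))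
          ∂(pinnedChain ω₂ lam β γ).gibbsMeasure N T) -
        (∫ z, f z ∂(pinnedChain ω₂ lam β γ).gibbsMeasure N T) *
          (∫ z, g z ∂(pinnedChain ω₂ lam β γ).gibbsMeasure N T))) →
    (∀ f g, cov f g = (∫ z, f z * g z ∂(pinnedChain ω₂ lam β γ).gibbsMeasure N T) -
      (∫ z, f z ∂(pinnedChain ω₂ lam β γ).gibbsMeasure N T) *
        (∫ z, g z ∂(pinnedChain ω₂ lam β γ).gibbsMeasure N T)) →
    ∀ s : ℝ, 0 < s → ∀ (w ℓ ℓ' : PhaseSpace N → ℝ), Adm w → Adm ℓ → Adm ℓ' →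
      (∀ (r : NNReal) (z : PhaseSpace N),
        (∫ y, w y ∂((pinnedChain ω₂ lam β γ).transitionKernel N T T r z)) - w z =
          ∫ u in (0 : ℝ)..(r : ℝ), ∫ y, ℓ y ∂((pinnedChain ω₂ lam β γ).transitionKernel N T T u.toNNReal z)) →
      (∀ (r : NNReal) (z : PhaseSpace N),
        (∫ y, (fun y : PhaseSpace N => w (y.1, -y.2)) y ∂((pinnedChain ω₂ lam β γ).transitionKernel N T T r z)) - (fun y : PhaseSpace N => w (y.1, -y.2)) z =
          ∫ u in (0 : ℝ)..(r : ℝ), ∫ y, ℓ' y ∂((pinnedChain ω₂ lam β γ).transitionKernel N T T u.toNNReal z)) →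
      lap s (fun z => (ℓ z - ℓ' (z.1, -z.2)) / 2) (fun z => (ℓ z - ℓ' (z.1, -z.2)) / 2) +
        lap s (fun z => s * w z - (ℓ z + ℓ' (z.1, -z.2)) / 2) (fun z => s * w z - (ℓ z + ℓ' (z.1, -z.2)) / 2) =
      cov w (fun z => s * w z - (ℓ z + ℓ' (z.1, -z.2)) / 2) - cov (fun z => (ℓ z - ℓ' (z.1, -z.2)) / 2) w) →
    (∀ ω₂ lam β γ : ℝ, 0 < ω₂ → 0 < lam → 0 < β → 0 < γ → ∀ T : ℝ, 0 < T →
    ∀ N : ℕ, 2 ≤ N → ∀ (w ℓ : PhaseSpace N → ℝ) (k : ℕ) (C : ℝ), ContDiff ℝ 2 w → Continuous ℓ →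
      (∀ z, (pinnedChain ω₂ lam β γ).generator N T T w z = ℓ z) →
      (∀ z, |w z| ≤ C * (1 + (pinnedChain ω₂ lam β γ).hamiltonian N z) ^ k) →
      (∀ (i : Fin N) z, (i.val = 0 ∨ i.val = N - 1) → |partialP i w z| ≤ C * (1 + (pinnedChain ω₂ lam β γ).hamiltonian N z) ^ k) →
      (∀ z, |ℓ z| ≤ C * (1 + (pinnedChain ω₂ lam β γ).hamiltonian N z) ^ k) →
      (∀ (r : NNReal) (z : PhaseSpace N),
        (∫ y, w y ∂((pinnedChain ω₂ lam β γ).transitionKernel N T T r z)) - w z =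
          ∫ u in (0 : ℝ)..(r : ℝ), ∫ y, ℓ y ∂((pinnedChain ω₂ lam β γ).transitionKernel N T T u.toNNReal z))) →
    (∀ ω₂ lam β γ T : ℝ, ∀ N : ℕ, ∀ w : PhaseSpace N → ℝ, ContDiff ℝ 2 w →
      (∀ z : PhaseSpace N, (pinnedChain ω₂ lam β γ).generator N T T (fun y => w (y.1, -y.2)) (z.1, -z.2) =
        (pinnedChain ω₂ lam β γ).generator N T T w z - 2 * (pinnedChain ω₂ lam β 0).generator N T T w z) ∧
      (∀ z : PhaseSpace N, (pinnedChain ω₂ lam β γ).generator N T T (fun y => w y ^ 2) z =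
        2 * w z * (pinnedChain ω₂ lam β γ).generator N T T w z +
          2 * γ * T * ∑ i : Fin N, ((if i.val = 0 then partialP i w z ^ 2 else 0) +
            (if i.val = N - 1 then partialP i w z ^ 2 else 0))) ∧
      (∀ z : PhaseSpace N, (pinnedChain ω₂ lam β γ).generator N T T w z = (pinnedChain ω₂ lam β 0).generator N T T w z +
        γ * ∑ i : Fin N, ((if i.val = 0 then T * partialP i (partialP i w) z - z.2 i * partialP i w z else 0) +
          (if i.val = N - 1 then T * partialP i (partialP i w) z - z.2 i * partialP i w z else 0)))) →
    (∀ ω₂ lam β γ : ℝ, 0 < ω₂ → 0 < lam → 0 < β → 0 < γ → ∀ T : ℝ, 0 < T →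
    ∀ N : ℕ, 2 ≤ N → ∀ (Adm : (PhaseSpace N → ℝ) → Prop),
    (∀ f, Adm f ↔ (Continuous f ∧ ∃ A : ℝ, ∀ z,
      |f z| ≤ A * Real.exp ((pinnedChain ω₂ lam β γ).hamiltonian N z / (8 * T)))) →
    ∀ (lap : ℝ → (PhaseSpace N → ℝ) → (PhaseSpace N → ℝ) → ℝ)
      (cov : (PhaseSpace N → ℝ) → (PhaseSpace N → ℝ) → ℝ),
    (∀ s f g, lap s f g = ∫ t in Set.Ioi (0 : ℝ), Real.exp (-(s * t)) *
      ((∫ z, f z * (∫ y, g y ∂((pinnedChain ω₂ lam β γ).transitionKernel N T T t.toNNReal z))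
          ∂(pinnedChain ω₂ lam β γ).gibbsMeasure N T) -
        (∫ z, f z ∂(pinnedChain ω₂ lam β γ).gibbsMeasure N T) *
          (∫ z, g z ∂(pinnedChain ω₂ lam β γ).gibbsMeasure N T))) →
    (∀ f g, cov f g = (∫ z, f z * g z ∂(pinnedChain ω₂ lam β γ).gibbsMeasure N T) -
      (∫ z, f z ∂(pinnedChain ω₂ lam β γ).gibbsMeasure N T) *
        (∫ z, g z ∂(pinnedChain ω₂ lam β γ).gibbsMeasure N T)) →
    ∀ s : ℝ, 0 < s → ∀ (f g : PhaseSpace N → ℝ), Adm f → Adm g →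
      0 ≤ lap s f f ∧
      lap s (fun z => f z + g z) (fun z => f z + g z) ≤
        lap s f f + lap s g g + 2 * Real.sqrt (lap s f f * lap s g g) ∧
      (∀ c : ℝ, lap s (fun z => c * f z) (fun z => c * f z) = c ^ 2 * lap s f f)) →
    (∀ ω₂ lam β γ : ℝ, 0 < ω₂ → 0 < lam → 0 < β → 0 < γ → ∀ T : ℝ, 0 < T →
    ∃ K : ℝ, 0 < K ∧ ∀ N : ℕ, 2 ≤ N → ∃ s₀ : ℝ, 0 < s₀ ∧
    ∀ (lap : ℝ → (PhaseSpace N → ℝ) → (PhaseSpace N → ℝ) → ℝ)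
      (cov : (PhaseSpace N → ℝ) → (PhaseSpace N → ℝ) → ℝ) (e : Fin N → PhaseSpace N → ℝ),
    (∀ s f g, lap s f g = ∫ t in Set.Ioi (0 : ℝ), Real.exp (-(s * t)) *
      ((∫ z, f z * (∫ y, g y ∂((pinnedChain ω₂ lam β γ).transitionKernel N T T t.toNNReal z))
          ∂(pinnedChain ω₂ lam β γ).gibbsMeasure N T) -
        (∫ z, f z ∂(pinnedChain ω₂ lam β γ).gibbsMeasure N T) *
          (∫ z, g z ∂(pinnedChain ω₂ lam β γ).gibbsMeasure N T))) →
    (∀ f g, cov f g = (∫ z, f z * g z ∂(pinnedChain ω₂ lam β γ).gibbsMeasure N T) -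
      (∫ z, f z ∂(pinnedChain ω₂ lam β γ).gibbsMeasure N T) *
        (∫ z, g z ∂(pinnedChain ω₂ lam β γ).gibbsMeasure N T)) →
    (∀ x z, e x z = z.2 x ^ 2 / 2 + (pinnedChain ω₂ lam β γ).U (z.1 x) +
      ∑ j : Fin N, ((if j.val = x.val + 1 then (pinnedChain ω₂ lam β γ).V (z.1 j - z.1 x) / 2 else 0) +
        (if x.val = j.val + 1 then (pinnedChain ω₂ lam β γ).V (z.1 x - z.1 j) / 2 else 0))) →
    ∀ s : ℝ, 0 < s → s < s₀ →
      (∀ (a η : Fin N → ℝ), (∀ b : Fin N, ¬ (b.val + 1 < N) → η b = 0) →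
        (∀ x : Fin N, ∑ y : Fin N, cov (e x) (e y) * a y =
          ∑ b : Fin N, if b.val + 1 < N then
            ((if x.val = b.val + 1 then (1 : ℝ) else 0) - (if x = b then 1 else 0)) *
              (∑ b' : Fin N, cov ((pinnedChain ω₂ lam β γ).bondCurrent N b) ((pinnedChain ω₂ lam β γ).bondCurrent N b') * η b') else 0) →
        γ * T * (∑ i : Fin N, ((if i.val = 0 then ∫ z, partialP i (fun y : PhaseSpace N => ∑ b : Fin N, η b * (pinnedChain ω₂ lam β γ).bondCurrent N b y) z ^ 2 ∂(pinnedChain ω₂ lam β γ).gibbsMeasure N T else 0) +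
            (if i.val = N - 1 then ∫ z, partialP i (fun y : PhaseSpace N => ∑ b : Fin N, η b * (pinnedChain ω₂ lam β γ).bondCurrent N b y) z ^ 2 ∂(pinnedChain ω₂ lam β γ).gibbsMeasure N T else 0))) +
          lap s (fun z : PhaseSpace N => (∑ x : Fin N, a x * e x z) + (pinnedChain ω₂ lam β 0).generator N T T (fun y : PhaseSpace N => ∑ b : Fin N, η b * (pinnedChain ω₂ lam β γ).bondCurrent N b y) z)
            (fun z : PhaseSpace N => (∑ x : Fin N, a x * e x z) + (pinnedChain ω₂ lam β 0).generator N T T (fun y : PhaseSpace N => ∑ b : Fin N, η b * (pinnedChain ω₂ lam β γ).bondCurrent N b y) z) ≤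
        K * ∑ b : Fin N, (∑ b' : Fin N, cov ((pinnedChain ω₂ lam β γ).bondCurrent N b) ((pinnedChain ω₂ lam β γ).bondCurrent N b') * η b') ^ 2) ∧
      (∀ c : Fin N → ℝ, (∀ x : Fin N, ∑ y : Fin N, cov (e x) (e y) * c y = if x.val = 0 then 1 else 0) →
        lap s (fun z : PhaseSpace N => ∑ y : Fin N, c y * e y z) (fun z : PhaseSpace N => ∑ y : Fin N, c y * e y z) ≤ K) ∧
      (∀ c : Fin N → ℝ, (∀ x : Fin N, ∑ y : Fin N, cov (e x) (e y) * c y = if x.val = N - 1 then 1 else 0) →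
        lap s (fun z : PhaseSpace N => ∑ y : Fin N, c y * e y z) (fun z : PhaseSpace N => ∑ y : Fin N, c y * e y z) ≤ K)) →
    ∀ ω₂ lam β γ : ℝ, 0 < ω₂ → 0 < lam → 0 < β → 0 < γ → ∀ T : ℝ, 0 < T →
    ∃ K : ℝ, 0 < K ∧ ∀ N : ℕ, 2 ≤ N → ∃ s₀ : ℝ, 0 < s₀ ∧
    ∀ (lap : ℝ → (PhaseSpace N → ℝ) → (PhaseSpace N → ℝ) → ℝ)
      (cov : (PhaseSpace N → ℝ) → (PhaseSpace N → ℝ) → ℝ) (e : Fin N → PhaseSpace N → ℝ),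
    (∀ s f g, lap s f g = ∫ t in Set.Ioi (0 : ℝ), Real.exp (-(s * t)) *
      ((∫ z, f z * (∫ y, g y ∂((pinnedChain ω₂ lam β γ).transitionKernel N T T t.toNNReal z))
          ∂(pinnedChain ω₂ lam β γ).gibbsMeasure N T) -
        (∫ z, f z ∂(pinnedChain ω₂ lam β γ).gibbsMeasure N T) *
          (∫ z, g z ∂(pinnedChain ω₂ lam β γ).gibbsMeasure N T))) →
    (∀ f g, cov f g = (∫ z, f z * g z ∂(pinnedChain ω₂ lam β γ).gibbsMeasure N T) -
      (∫ z, f z ∂(pinnedChain ω₂ lam β γ).gibbsMeasure N T) *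
        (∫ z, g z ∂(pinnedChain ω₂ lam β γ).gibbsMeasure N T)) →
    (∀ x z, e x z = z.2 x ^ 2 / 2 + (pinnedChain ω₂ lam β γ).U (z.1 x) +
      ∑ j : Fin N, ((if j.val = x.val + 1 then (pinnedChain ω₂ lam β γ).V (z.1 j - z.1 x) / 2 else 0) +
        (if x.val = j.val + 1 then (pinnedChain ω₂ lam β γ).V (z.1 x - z.1 j) / 2 else 0))) →
    ∀ s : ℝ, 0 < s → s < s₀ → ∀ (a ψ : Fin N → ℝ) (φ₀ φ₁ : ℝ),
      (∀ x : Fin N, ∑ y : Fin N, cov (e x) (e y) * a y =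
        (∑ b : Fin N, if b.val + 1 < N then
          ((if x.val = b.val + 1 then ψ b else 0) - (if x = b then ψ b else 0)) else 0) +
        (if x.val = 0 then φ₀ else 0) + (if x.val = N - 1 then φ₁ else 0)) →
      ∑ x : Fin N, ∑ y : Fin N, a x * lap s (e x) (e y) * a y ≤
        K * ((∑ b : Fin N, if b.val + 1 < N then ψ b ^ 2 else 0) + φ₀ ^ 2 + φ₁ ^ 2) := by
  sorry

/-! ### The flux bound and the crux -/

/-- The N-uniform flux bound (`stub_fluxBound` of line LinAlg) from the Sketch certificate stubs. -/
theorem fluxBound_of_certificate :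
    ∀ ω₂ lam β γ : ℝ, 0 < ω₂ → 0 < lam → 0 < β → 0 < γ → ∀ T : ℝ, 0 < T →
    ∃ K : ℝ, 0 < K ∧ ∀ N : ℕ, 2 ≤ N → ∃ s₀ : ℝ, 0 < s₀ ∧
    ∀ (lap : ℝ → (PhaseSpace N → ℝ) → (PhaseSpace N → ℝ) → ℝ)
      (cov : (PhaseSpace N → ℝ) → (PhaseSpace N → ℝ) → ℝ) (e : Fin N → PhaseSpace N → ℝ),
    (∀ s f g, lap s f g = ∫ t in Set.Ioi (0 : ℝ), Real.exp (-(s * t)) *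
      ((∫ z, f z * (∫ y, g y ∂((pinnedChain ω₂ lam β γ).transitionKernel N T T t.toNNReal z))
          ∂(pinnedChain ω₂ lam β γ).gibbsMeasure N T) -
        (∫ z, f z ∂(pinnedChain ω₂ lam β γ).gibbsMeasure N T) *
          (∫ z, g z ∂(pinnedChain ω₂ lam β γ).gibbsMeasure N T))) →
    (∀ f g, cov f g = (∫ z, f z * g z ∂(pinnedChain ω₂ lam β γ).gibbsMeasure N T) -
      (∫ z, f z ∂(pinnedChain ω₂ lam β γ).gibbsMeasure N T) *
        (∫ z, g z ∂(pinnedChain ω₂ lam β γ).gibbsMeasure N T)) →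
    (∀ x z, e x z = z.2 x ^ 2 / 2 + (pinnedChain ω₂ lam β γ).U (z.1 x) +
      ∑ j : Fin N, ((if j.val = x.val + 1 then (pinnedChain ω₂ lam β γ).V (z.1 j - z.1 x) / 2 else 0) +
        (if x.val = j.val + 1 then (pinnedChain ω₂ lam β γ).V (z.1 x - z.1 j) / 2 else 0))) →
    ∀ s : ℝ, 0 < s → s < s₀ → ∀ (a ψ : Fin N → ℝ) (φ₀ φ₁ : ℝ),
      (∀ x : Fin N, ∑ y : Fin N, cov (e x) (e y) * a y =
        (∑ b : Fin N, if b.val + 1 < N then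
          ((if x.val = b.val + 1 then ψ b else 0) - (if x = b then ψ b else 0)) else 0) +
        (if x.val = 0 then φ₀ else 0) + (if x.val = N - 1 then φ₁ else 0)) →
      ∑ x : Fin N, ∑ y : Fin N, a x * lap s (e x) (e y) * a y ≤
        K * ((∑ b : Fin N, if b.val + 1 < N then ψ b ^ 2 else 0) + φ₀ ^ 2 + φ₁ ^ 2) := stub_certificateTransfer stub_coboundaryIdentity stub_polyDynkin stub_generatorCalculus stub_lapSeminorm
    stub_junkContactBound

/-- **`RobinCoercivity`** (crux stmt-AtomisticToContinuum-12695 of route `HonestZwanzig`) from the Sketch certificate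
stubs, through the landed transfer `robinCoercivity_of_fluxBound` (line LinAlg, p101879). -/
theorem RobinCoercivity_of : RobinCoercivity :=
  robinCoercivity_of_fluxBound fluxBound_of_certificate

end Summit.AtomisticToContinuum.FouriersLaw.Theorems.HonestZwanzig.Robin

end
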